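import Mathlib
import Summits.NavierStokesRegularity.NavierStokesRegularity.Theorems.SubOnsagerCeilingSideBranchChainDrive
import HarnessLib

/-!
# Route SubOnsagerCeiling — the DATUM CHAIN MODE of `α_SB` EMPTIES (quantitatively, uniformly in `ν`)
# (helper file for item stmt-NavierStokesRegularity-25507 `OrthantTailCeiling`; `--supports`; def-free)

Brick toward the per-shell retention target `SideBranchShellRetentionAt` (p825614; its first conjunct:
the datum shell holds `≤ η₀E₀` at a `ν`-uniform time).  The chain mode `x₀` of the datum shell is
non-increasing (it is only drained: by the chain receiver `x₁`, by its side pump into `s₀`, by viscosity),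
and it cannot stall: while `x₀ ≥ r` the side mode is driven up to `m = Λ₀r²/(5r₁)` (`r₁ = Λ₀M/5 + ν₀`,
`M ≥ z₁` a cap on the first pocket, e.g. `√(2E₀)`), and then drains `x₀` at rate `≥ Λ₀ r m/5`:

* `sideBranch_datum_chain_decay` — along a regular `ν`-viscous solution on `[0,s]` (`ν ≥ 0`, no shells
  below `0`), if on `[0,T] ⊆ [0,s]`: `x₀, x₁, s₀ ≥ 0`, `z₁ ≤ M` (`M > 0`), and `x₀(T) ≥ r > 0`, then
  **`(Λ₀² r³/(25 r₁))·(T − 1/r₁) ≤ x₀(0) − x₀(T)`**.  Contrapositively `x₀(T) < r` as soon as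
  `T > 1/r₁ + 25 r₁ x₀(0)/(Λ₀² r³)` — an explicit, viscosity-uniform (for `ν ≤ 1`) relaxation time.

(The signs `x₀ ≥ 0`, `s₀ ≥ 0` along solutions from a datum with `x₀(0) ≥ 0`, `s₀(0) = 0` are
`sideBranch_chain_zero_nonneg` / `sideBranch_side_zero_nonneg` of `…SideBranchShellZero`; `x₁, z₁ ≥ 0` is cone
invariance; `½z₁² ≤ E₀` is the block energy bound.)

HONEST FRAMING: elementary real analysis of a Tao-type MODEL lattice ODE (route SubOnsagerCeiling, rung
TL-M2Break); a brick toward a construction that is NOT carried out here; nothing bears on Navier–Stokes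
regularity; no crux is settled here. [cite: Tao2016AveragedNS, §4 (4.2)–(4.3)];
Katz–Pavlović couplings: [cite: BarbatoMorandinRomito2011, §2].
-/

noncomputable section

-- the sub-problem namespace `NavierStokesRegularity.NavierStokesRegularity` is the tree's layout (D-0017)
set_option linter.dupNamespace false

namespace Summit.NavierStokesRegularity.NavierStokesRegularity.Theorems.SubOnsagerCeiling

open Set
open Literature.Analysis.FluidPDE.TaoCascade

section Solution

variable {ε₀ ν s : ℝ} {X : Fin 4 → ℤ → ℝ → ℝ}

/-- **The datum chain mode empties.** Along a regular solution of the `ν`-viscous `α_SB` lattice on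
`[0,s]` (`ν ≥ 0`, no shells below `0`), let `0 < T ≤ s` and suppose on `[0,T]`: `x₀ ≥ 0`, `x₁ ≥ 0`,
`s₀ ≥ 0`, `z₁ ≤ M` with `M > 0`, and `x₀(T) ≥ r > 0`.  Then
`(Λ₀² r³ / (25 r₁))·(T − 1/r₁) ≤ x₀(0) − x₀(T)` with `r₁ = Λ₀M/5 + ν₀`
(`Λ₀ = (1+ε₀)^{0} = 1` written as the shell-`0` instance of `Λ_n = (1+ε₀)^{5n/2}`, `ν₀ = ν(1+ε₀)^{0}`;
equations `ẋ₀ = −Λ₀x₀(x₁ + s₀/5) − ν₀x₀`, `ṡ₀ = Λ₀(x₀² − s₀z₁)/5 − ν₀s₀`). [this file] -/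
theorem sideBranch_datum_chain_decay (hε : 0 < ε₀) (hν : 0 ≤ ν)
    (hlow : ∀ (i : Fin 4) (k : ℤ), k < 0 → ∀ t : ℝ, X i k t = 0)
    (hder : ∀ (i : Fin 4) (k : ℤ), ∀ t ∈ Icc (0 : ℝ) s, HasDerivWithinAt (X i k)
      (quadTerm ε₀ sideBranchTable X i k t - ν * (1 + ε₀) ^ ((2 : ℝ) * k) * X i k t)
      (Icc (0 : ℝ) s) t)
    {T M r : ℝ} (hT : 0 < T) (hTs : T ≤ s) (hM : 0 < M) (hr : 0 < r)
    (hx0 : ∀ u ∈ Icc (0 : ℝ) T, 0 ≤ X 0 0 u)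
    (hx1 : ∀ u ∈ Icc (0 : ℝ) T, 0 ≤ X 0 1 u)
    (hs0 : ∀ u ∈ Icc (0 : ℝ) T, 0 ≤ X 1 0 u)
    (hzM : ∀ u ∈ Icc (0 : ℝ) T, X 2 1 u ≤ M)
    (hxT : r ≤ X 0 0 T) :
    ((1 + ε₀) ^ ((5 : ℝ) * ((0 : ℤ) : ℝ) / 2)) ^ 2 * r ^ 3 /
          (25 * ((1 / 5 : ℝ) * (1 + ε₀) ^ ((5 : ℝ) * ((0 : ℤ) : ℝ) / 2) * M +
            ν * (1 + ε₀) ^ ((2 : ℝ) * ((0 : ℤ) : ℝ)))) *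
        (T - 1 / ((1 / 5 : ℝ) * (1 + ε₀) ^ ((5 : ℝ) * ((0 : ℤ) : ℝ) / 2) * M +
          ν * (1 + ε₀) ^ ((2 : ℝ) * ((0 : ℤ) : ℝ)))) ≤
      X 0 0 0 - X 0 0 T := by
  have hb : (0 : ℝ) < 1 + ε₀ := by linarith
  set Λ : ℝ := (1 + ε₀) ^ ((5 : ℝ) * ((0 : ℤ) : ℝ) / 2) with hΛ
  set c₀ : ℝ := ν * (1 + ε₀) ^ ((2 : ℝ) * ((0 : ℤ) : ℝ)) with hc₀
  have hΛ0 : 0 < Λ := Real.rpow_pos_of_pos hb _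
  have hc₀0 : 0 ≤ c₀ := mul_nonneg hν (Real.rpow_nonneg hb.le _)
  set r₁ : ℝ := (1 / 5 : ℝ) * Λ * M + c₀ with hr₁def
  have hr₁ : 0 < r₁ := by
    have : 0 < (1 / 5 : ℝ) * Λ * M := by positivity
    rw [hr₁def]; linarith
  have hsub : Icc (0 : ℝ) T ⊆ Icc (0 : ℝ) s := Icc_subset_Icc le_rfl hTs
  -- the equation of `x₀` within `[0,T]` and its sign: `ẋ₀ ≤ 0`
  have hxder : ∀ u ∈ Icc (0 : ℝ) T, HasDerivWithinAt (X 0 0)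
      (quadTerm ε₀ sideBranchTable X 0 0 u - c₀ * X 0 0 u) (Icc (0 : ℝ) T) u :=
    fun u hu => (hder 0 0 u (hsub hu)).mono hsub
  have hq0 : ∀ u ∈ Icc (0 : ℝ) T, quadTerm ε₀ sideBranchTable X 0 0 u - c₀ * X 0 0 u =
      -(Λ * (X 0 0 u * X 0 1 u) + (1 / 5 : ℝ) * Λ * (X 0 0 u * X 1 0 u) + c₀ * X 0 0 u) := by
    intro u hu
    rw [sideBranch_quadTerm_zero, ← hΛ]
    have h1 : X 0 (0 - 1) u = 0 := hlow 0 (0 - 1) (by norm_num) u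
    rw [h1]; ring
  -- Step 1: `x₀` is non-increasing on `[0,T]`, hence `x₀ ≥ r` throughout
  have hmono : ∀ u ∈ Icc (0 : ℝ) T, X 0 0 T ≤ X 0 0 u := by
    intro u hu
    have hsubu : Icc u T ⊆ Icc (0 : ℝ) T := Icc_subset_Icc hu.1 le_rfl
    have hderΨ : ∀ w ∈ Icc u T, HasDerivWithinAt (fun w => -X 0 0 w)
        (-(quadTerm ε₀ sideBranchTable X 0 0 w - c₀ * X 0 0 w)) (Icc u T) w :=
      fun w hw => ((hxder w (hsubu hw)).mono hsubu).neg
    have hpos : ∀ w ∈ Icc u T, 0 ≤ -(quadTerm ε₀ sideBranchTable X 0 0 w - c₀ * X 0 0 w) := by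
      intro w hw
      have hw' := hsubu hw
      rw [hq0 w hw', neg_neg]
      have := hx0 w hw'; have := hx1 w hw'; have := hs0 w hw'
      positivity
    have h := sideBranch_le_of_deriv_nonneg hderΨ hpos (right_mem_Icc.2 hu.2)
    linarith
  have hxr : ∀ u ∈ Icc (0 : ℝ) T, r ≤ X 0 0 u := fun u hu => hxT.trans (hmono u hu)
  -- Step 2: the side mode is driven: `s₀(u) ≥ m(1 − e^{−r₁ u})`, `m = (Λ r²/5)/r₁`
  have hsder : ∀ u ∈ Icc (0 : ℝ) T, HasDerivWithinAt (X 1 0)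
      (quadTerm ε₀ sideBranchTable X 1 0 u - c₀ * X 1 0 u) (Icc (0 : ℝ) T) u :=
    fun u hu => (hder 1 0 u (hsub hu)).mono hsub
  have hsf : ∀ u ∈ Icc (0 : ℝ) T, (1 / 5 : ℝ) * Λ * r ^ 2 - r₁ * X 1 0 u ≤
      quadTerm ε₀ sideBranchTable X 1 0 u - c₀ * X 1 0 u := by
    intro u hu
    rw [sideBranch_quadTerm_one, ← hΛ]
    have h1 : X 1 0 u * X 2 (0 + 1) u ≤ X 1 0 u * M :=
      mul_le_mul_of_nonneg_left (by simpa using hzM u hu) (hs0 u hu)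
    have h2 : (1 / 5 : ℝ) * Λ * (X 1 0 u * X 2 (0 + 1) u) ≤ (1 / 5 : ℝ) * Λ * (X 1 0 u * M) :=
      mul_le_mul_of_nonneg_left h1 (by positivity)
    have h3 : r₁ * X 1 0 u = (1 / 5 : ℝ) * Λ * (X 1 0 u * M) + c₀ * X 1 0 u := by rw [hr₁def]; ring
    have h4 : r ^ 2 ≤ X 0 0 u ^ 2 := pow_le_pow_left₀ hr.le (hxr u hu) 2
    have h5 : (1 / 5 : ℝ) * Λ * r ^ 2 ≤ (1 / 5 : ℝ) * Λ * X 0 0 u ^ 2 :=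
      mul_le_mul_of_nonneg_left h4 (by positivity)
    linarith
  have hs00 : 0 ≤ X 1 0 0 := hs0 0 ⟨le_rfl, hT.le⟩
  have hdrive : ∀ u ∈ Icc (0 : ℝ) T,
      (1 / 5 : ℝ) * Λ * r ^ 2 / r₁ * (1 - Real.exp (-(r₁ * (u - 0)))) ≤ X 1 0 u :=
    fun u hu => sideBranch_drive_lower_bound hr₁ hsder hsf hs00 hu
  -- Step 3: accumulation on `G = −x₀`: `G' ≥ (Λ r/5)·s₀`
  have hG : ∀ u ∈ Icc (0 : ℝ) T, HasDerivWithinAt (fun w => -X 0 0 w)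
      (-(quadTerm ε₀ sideBranchTable X 0 0 u - c₀ * X 0 0 u)) (Icc (0 : ℝ) T) u :=
    fun u hu => (hxder u hu).neg
  have hG' : ∀ u ∈ Icc (0 : ℝ) T, (1 / 5 : ℝ) * Λ * r * X 1 0 u ≤
      -(quadTerm ε₀ sideBranchTable X 0 0 u - c₀ * X 0 0 u) := by
    intro u hu
    rw [hq0 u hu, neg_neg]
    have h1 : r * X 1 0 u ≤ X 0 0 u * X 1 0 u := mul_le_mul_of_nonneg_right (hxr u hu) (hs0 u hu)
    have h2 : (1 / 5 : ℝ) * Λ * (r * X 1 0 u) ≤ (1 / 5 : ℝ) * Λ * (X 0 0 u * X 1 0 u) :=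
      mul_le_mul_of_nonneg_left h1 (by positivity)
    have h3 : 0 ≤ Λ * (X 0 0 u * X 0 1 u) := mul_nonneg hΛ0.le (mul_nonneg (hx0 u hu) (hx1 u hu))
    have h4 : 0 ≤ c₀ * X 0 0 u := mul_nonneg hc₀0 (hx0 u hu)
    linarith
  have hgain := sideBranch_drive_gain (G := fun w => -X 0 0 w) hr₁ (by positivity : (0 : ℝ) ≤ (1 / 5 : ℝ) * Λ * r)
    (by positivity : (0 : ℝ) ≤ (1 / 5 : ℝ) * Λ * r ^ 2 / r₁) hG hG' hdrive hT.le
  simp only [sub_zero] at hgain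
  have hid : (1 / 5 : ℝ) * Λ * r * ((1 / 5 : ℝ) * Λ * r ^ 2 / r₁) = Λ ^ 2 * r ^ 3 / (25 * r₁) := by
    field_simp; ring
  rw [hid] at hgain
  have hfin : Λ ^ 2 * r ^ 3 / (25 * r₁) * (T - 1 / r₁) ≤ X 0 0 0 - X 0 0 T := by linarith
  simpa only [hr₁def, hΛ, hc₀] using hfin

end Solution

end Summit.NavierStokesRegularity.NavierStokesRegularity.Theorems.SubOnsagerCeiling

end
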